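import Mathlib
import Summits.ResolutionOfSingularities.ResolutionOfSingularities.Theorems.WeightedInvariantLocalWeightedDropNCResSurfGraphLoopDefs
import Summits.ResolutionOfSingularities.ResolutionOfSingularities.Theorems.WeightedInvariantLocalWeightedDropNCResRegimeTransport

/-!
# `WeightedInvariant.LocalWeightedDrop`: NC-resolution settings for the TOT₂ line — GRAPH SURFACES, part 20: THE POINT MOVE EXPOSES ITS SUCCESSOR DATUM

Crux item stmt-ResolutionOfSingularities-8899 `LocalWeightedDrop` (route `ResolutionOfSingularities/WeightedInvariant`), ENGINE skeleton v34/v35, residual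
`stub_wildWideApexFourStartsWon`; res-L1-w43-strat-1's line `directrix-cut` v3f, piece PL₃, sub-skeleton `pl3_split_v1` (7519a9009475ab47), stub
`stub_apexPlaneSurfaceThree` = the SURFACE sub-case `ApexPlaneSurfaceExit`, reduced (…NCResSurfGraphRegime, p557720) to the loop `SurfLoop k m`.
Design memo `L/res-L1-w43-stub-4/g6/SURFLOOP-DESIGN.md`.  [OURS · L1 W4.3 · chain w43 · seat res-L1-w43-stub-4 gen 6; def-free, on parts 1–19 and 22
(…NCResSurfGraph*), res-L1-w43-stub-1's S-SET and res-L1-w43-lead-1's boundary bookkeeping (…NCResRegimeTransport); the count game is the programme's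
own; nothing here is a statement of any manuscript; AI-produced, gate-checked, weaker than expert review.]

* `SurfDatum.Valid.swap` — validity passes to the swapped reading;
* `admissible_pointSucc`, `head_pointSucc_le`, `tangent_of_head_eq` (part 5), `valid_pointSucc` (parts 6, 6a, 7 with the exceptional letter FIRST);
* the letters of the successor: `a_mem_E_pointSucc`, `b_mem_E_pointSucc_iff`, `mem_off_pointSucc_iff` / `off_pointSucc_eq_image` (re-indexed
  off-base boundary letters passing through the answer), and its traces `pointSucc_ψ_predAbove` = `(ψ_l(λx₀, x₀(μ+x₁)) − c_l x₀)/x₀`.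
-/

set_option linter.dupNamespace false -- mandated namespace of this single-conjunct summit

noncomputable section

namespace Summit.ResolutionOfSingularities.ResolutionOfSingularities.Theorems

namespace TameFourTupleDrop

namespace GraphSurf

namespace SurfDatum

open MvPowerSeries Literature.AlgebraicGeometry.Resolution

variable {k : Type} [Field k] {m : ℕ}

/-- Validity passes to the swapped reading. -/
theorem Valid.swap {σ : SurfDatum k m} (h : σ.Valid) : σ.swap.Valid := by
  obtain ⟨hadm, hab, hψ, hperm, htwo⟩ := h
  refine ⟨hadm, hab.symm, constantCoeff_swap_of_ne hψ, ?_, htwo⟩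
  show InOffPlaneIdeal σ.b σ.a σ.δ.c (subst (shear σ.b σ.a fun j => subst ![X 1, X 0] (σ.ψ j)) (σ.δ.f * ∏ l ∈ σ.δ.O, X l))
  rw [← shear_swap]
  exact hperm.symm

/-- The swap is an involution on traces. -/
theorem subst_swap_subst_swap (ψ : MvPowerSeries (Fin 2) k) :
    subst (![X 1, X 0] : Fin 2 → MvPowerSeries (Fin 2) k) (subst (![X 1, X 0] : Fin 2 → MvPowerSeries (Fin 2) k) ψ) = ψ := by
  rw [subst_comp_subst_apply TOT2Curve.hasSubst_swap TOT2Curve.hasSubst_swap]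
  have hfam : (fun t : Fin 2 => subst (![X 1, X 0] : Fin 2 → MvPowerSeries (Fin 2) k)
      ((![X 1, X 0] : Fin 2 → MvPowerSeries (Fin 2) k) t)) = fun t => X t := by
    funext t
    fin_cases t
    · simp [subst_X TOT2Curve.hasSubst_swap]
    · simp [subst_X TOT2Curve.hasSubst_swap]
  rw [hfam]
  exact congrFun subst_self ψ

/-- The off-base letters of the swapped reading. -/
theorem off_swap (σ : SurfDatum k m) : σ.swap.off = σ.off := by
  ext l
  simp only [mem_off_iff, swap_δ, swap_a, swap_bLetter]
  tauto

/-! ### The successor of the point move, read at the first base letter -/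

/-- The successor is admissibly decorated (any live slot; here the first base letter). -/
theorem admissible_pointSucc {σ : SurfDatum k m} (hσ : σ.Valid) {c : Fin (m + 1) → k} {A : ℕ} {G : MvPowerSeries (Fin (m + 1 + 1)) k}
    (hfac : subst (CobordantChart.chart (fun _ : Fin (m + 1) => 1) c) σ.b₀ = X 0 ^ A * G) (hG : ¬ X 0 ∣ G) (hca : c σ.a ≠ 0) :
    Admissible (σ.pointSucc c G).b₀ (σ.pointSucc c G).δ := by
  have hfacX : subst (CobordantChart.chart (fun _ : Fin (m + 1) => 1) c)
      (subst (fun j => (X j : MvPowerSeries (Fin (m + 1)) k)) σ.b₀) = X 0 ^ A * G := by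
    rw [show subst (fun j => (X j : MvPowerSeries (Fin (m + 1)) k)) σ.b₀ = σ.b₀ from congrFun subst_self _]
    exact hfac
  exact admissible_transform hσ.1 (isBPermissible_point_X σ.δ) (fun _ h => absurd h one_ne_zero) hfacX hG hca

/-- The head does not rise. -/
theorem head_pointSucc_le {σ : SurfDatum k m} (hσ : σ.Valid) (c : Fin (m + 1) → k) (G : MvPowerSeries (Fin (m + 1 + 1)) k)
    (hca : c σ.a ≠ 0) : (σ.pointSucc c G).δ.head ≤ σ.δ.head :=
  Decoration.head_transform_le (isBPermissible_point_X σ.δ) (fun _ h => absurd h one_ne_zero) hσ.1.2.1.ne_zero hca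

/-- **AT A SAME-HEAD ANSWER THE ANSWER LIES IN THE TANGENT PLANE** (part 5 re-packaged): if at SOME live slot the head did not drop, then
`c = c_a·t_L + c_b·t_R` with `(c_a, c_b) ≠ 0`. -/
theorem tangent_of_head_eq [Infinite k] {σ : SurfDatum k m} (hσ : σ.Valid) {c : Fin (m + 1) → k} {i : Fin (m + 1)} (hci : c i ≠ 0)
    (hhead : (σ.δ.transform (fun j => (X j : MvPowerSeries (Fin (m + 1)) k)) (fun _ => 1) c i).head = σ.δ.head) :
    c = c σ.a • tangentL σ.a σ.b σ.ψ + c σ.b • tangentR σ.a σ.b σ.ψ ∧ (c σ.a ≠ 0 ∨ c σ.b ≠ 0) := by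
  obtain ⟨hadm, hab, hψ, hperm, htwo⟩ := hσ
  have hf : σ.δ.f ≠ 0 := hadm.2.1.ne_zero
  obtain ⟨H, U, hfacH, hH, -, -⟩ := Decoration.totalO_chart_eq (isBPermissible_point_X σ.δ) (fun _ h => absurd h one_ne_zero) hf hci
  rw [show subst (fun j => (X j : MvPowerSeries (Fin (m + 1)) k)) (σ.δ.f * ∏ l ∈ σ.δ.O, X l) = σ.δ.f * ∏ l ∈ σ.δ.O, X l from
    congrFun subst_self _] at hfacH
  exact tangentPlane_answer_of_head_eq hadm hab hψ hperm htwo hci hfacH hH hhead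

/-- The coordinates of a tangent-plane answer off the base: `c_l = c_a ∂₀ψ_l(0) + c_b ∂₁ψ_l(0)`. -/
theorem answer_apply {σ : SurfDatum k m} {c : Fin (m + 1) → k} (hc : c = c σ.a • tangentL σ.a σ.b σ.ψ + c σ.b • tangentR σ.a σ.b σ.ψ)
    {l : Fin (m + 1)} (hl : ¬ (l = σ.a ∨ l = σ.b)) :
    c l = c σ.a * coeff (Finsupp.single 0 1) (σ.ψ l) + c σ.b * coeff (Finsupp.single 1 1) (σ.ψ l) :=
  answer_apply_of_eq_combo_tangent hc hl

/-- **THE SUCCESSOR OF THE POINT MOVE IS A VALID LOOP STATE** (parts 6, 6a, 7 re-packaged with the exceptional letter first). -/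
theorem valid_pointSucc [Infinite k] {σ : SurfDatum k m} (hσ : σ.Valid) {c : Fin (m + 1) → k}
    (hc : c = c σ.a • tangentL σ.a σ.b σ.ψ + c σ.b • tangentR σ.a σ.b σ.ψ) (hca : c σ.a ≠ 0)
    {A : ℕ} {G : MvPowerSeries (Fin (m + 1 + 1)) k}
    (hfac : subst (CobordantChart.chart (fun _ : Fin (m + 1) => 1) c) σ.b₀ = X 0 ^ A * G) (hG : ¬ X 0 ∣ G)
    (hhead : (σ.pointSucc c G).δ.head = σ.δ.head) : (σ.pointSucc c G).Valid := by
  obtain ⟨hadm, hab, hψ, hperm, htwo⟩ := hσ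
  have hadm' := admissible_pointSucc ⟨hadm, hab, hψ, hperm, htwo⟩ hfac hG hca
  have hcoord : ∀ j, ¬ (j = σ.a ∨ j = σ.b) → c j = c σ.a * coeff (Finsupp.single 0 1) (σ.ψ j) + c σ.b * coeff (Finsupp.single 1 1) (σ.ψ j) :=
    fun j hj => answer_apply_of_eq_combo_tangent hc hj
  refine ⟨hadm', (predAbove_succ_ne_zero' hab).symm, ?_, ?_, ?_⟩
  · intro j hj
    rw [pointSucc_ψ, constantCoeff_swap]
    exact constantCoeff_step₂_of_ne σ.ψ hcoord j (fun h => hj (Or.comm.mp h))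
  · have h := inOffPlaneIdeal_transform hab hadm hψ hperm hc hca hhead
    rw [shear_swap (Fin.predAbove σ.a σ.b.succ) 0] at h
    exact h.symm
  · exact apexPlane_transform_of_head_eq hadm htwo hca hhead hadm'

/-! ### The letters of the successor -/

/-- The exceptional letter (the new first base letter) is a boundary letter. -/
theorem a_mem_E_pointSucc (σ : SurfDatum k m) (c : Fin (m + 1) → k) (G : MvPowerSeries (Fin (m + 1 + 1)) k) :
    (σ.pointSucc c G).a ∈ (σ.pointSucc c G).δ.E :=
  TameFourTupleDrop.Decoration.zero_mem_transform_E_X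

/-- `predAbove a (succ l) = (q).succ` for `l = a.succAbove q`. -/
theorem predAbove_succ_eq {a l : Fin (m + 1)} (h : l ≠ a) :
    ∃ q : Fin m, a.succAbove q = l ∧ Fin.predAbove a l.succ = q.succ := by
  obtain ⟨q, rfl⟩ := Fin.exists_succAbove_eq h
  exact ⟨q, rfl, TOT2Near.predAbove_succ_succAbove_succ a q⟩

/-- Re-indexing is injective off the slot. -/
theorem predAbove_succ_injOn {a l l' : Fin (m + 1)} (hl : l ≠ a) (hl' : l' ≠ a)
    (h : Fin.predAbove a l.succ = Fin.predAbove a l'.succ) : l = l' := by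
  obtain ⟨q, rfl, hq⟩ := predAbove_succ_eq hl
  obtain ⟨q', rfl, hq'⟩ := predAbove_succ_eq hl'
  rw [hq, hq'] at h
  rw [Fin.succ_inj.mp h]

/-- The second base letter of the successor is a boundary letter iff `b` was one and passes through the answer (`c_b = 0`). -/
theorem b_mem_E_pointSucc_iff {σ : SurfDatum k m} (hab : σ.a ≠ σ.b) {c : Fin (m + 1) → k} (hca : c σ.a ≠ 0)
    (G : MvPowerSeries (Fin (m + 1 + 1)) k) :
    (σ.pointSucc c G).b ∈ (σ.pointSucc c G).δ.E ↔ σ.b ∈ σ.δ.E ∧ c σ.b = 0 := by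
  obtain ⟨q, hq, hpred⟩ := predAbove_succ_eq (Ne.symm hab)
  rw [pointSucc_bLetter, pointSucc_δ, hpred, TameFourTupleDrop.Decoration.succ_mem_transform_E_X_iff hca, hq]

/-- THE OFF-BASE BOUNDARY LETTERS OF THE SUCCESSOR are the re-indexed off-base boundary letters passing through the answer. -/
theorem mem_off_pointSucc_iff {σ : SurfDatum k m} (hab : σ.a ≠ σ.b) {c : Fin (m + 1) → k} (hca : c σ.a ≠ 0)
    (G : MvPowerSeries (Fin (m + 1 + 1)) k) (l' : Fin (m + 1)) :
    l' ∈ (σ.pointSucc c G).off ↔ ∃ l ∈ σ.off, c l = 0 ∧ Fin.predAbove σ.a l.succ = l' := by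
  rw [mem_off_iff, pointSucc_δ, pointSucc_a, pointSucc_bLetter, TameFourTupleDrop.Decoration.mem_transform_E_X_iff]
  constructor
  · rintro ⟨h | ⟨l, hl, hcl, he⟩, hne⟩
    · exact absurd (Or.inl h) hne
    · have hla : l ≠ σ.a := fun h => hca (h ▸ hcl)
      refine ⟨l, (mem_off_iff σ l).mpr ⟨hl, ?_⟩, hcl, he⟩
      rintro (h | h)
      · exact hla h
      · apply hne
        right
        rw [← he, h]
  · rintro ⟨l, hl, hcl, he⟩
    obtain ⟨hlE, hlab⟩ := (mem_off_iff σ l).mp hl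
    have hla : l ≠ σ.a := fun h => hlab (Or.inl h)
    refine ⟨Or.inr ⟨l, hlE, hcl, he⟩, ?_⟩
    obtain ⟨q, rfl, hq⟩ := predAbove_succ_eq hla
    rintro (h | h)
    · rw [← he, hq] at h
      exact Fin.succ_ne_zero q h
    · rw [← he] at h
      exact hlab (Or.inr (predAbove_succ_injOn hla (Ne.symm hab) h))

open Classical in
/-- The off-base boundary letters of the successor, as an image. -/
theorem off_pointSucc_eq_image {σ : SurfDatum k m} (hab : σ.a ≠ σ.b) {c : Fin (m + 1) → k} (hca : c σ.a ≠ 0)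
    (G : MvPowerSeries (Fin (m + 1 + 1)) k) :
    (σ.pointSucc c G).off = (σ.off.filter fun l => c l = 0).image fun l => Fin.predAbove σ.a l.succ := by
  ext l'
  rw [mem_off_pointSucc_iff hab hca, Finset.mem_image]
  simp only [Finset.mem_filter]
  constructor
  · rintro ⟨l, hl, hcl, he⟩
    exact ⟨l, ⟨hl, hcl⟩, he⟩
  · rintro ⟨l, ⟨hl, hcl⟩, he⟩
    exact ⟨l, hl, hcl, he⟩

/-- THE TRACES OF THE SUCCESSOR: at the re-indexed letter `l⁺` the trace is `(ψ_l(λx₀, x₀(μ+x₁)) − c_l x₀)/x₀` — part 6's step series with the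
two variables exchanged (`(λ, μ) = (c_a, c_b)`). -/
theorem pointSucc_ψ_predAbove (σ : SurfDatum k m) (c : Fin (m + 1) → k) (G : MvPowerSeries (Fin (m + 1 + 1)) k) {l : Fin (m + 1)}
    (hl : l ≠ σ.a) :
    (σ.pointSucc c G).ψ (Fin.predAbove σ.a l.succ) =
      subst (![X 1, X 0] : Fin 2 → MvPowerSeries (Fin 2) k) (stepSeries₂ (σ.ψ l) (c σ.a) (c σ.b) (c l)) := by
  obtain ⟨q, rfl, hq⟩ := predAbove_succ_eq hl
  rw [pointSucc_ψ, hq, step₂_succ]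


end SurfDatum

end GraphSurf

end TameFourTupleDrop

end Summit.ResolutionOfSingularities.ResolutionOfSingularities.Theorems

end
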